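import Mathlib.AlgebraicGeometry.Morphisms.ClosedImmersion
import Mathlib.AlgebraicGeometry.Modules.Sheaf
import Mathlib.CategoryTheory.Sites.DenseSubsite.Basic
import Mathlib.CategoryTheory.Adjunction.FullyFaithful
import Mathlib.Topology.Sheaves.LocallySurjective
import Mathlib.CategoryTheory.Sites.Abelian
import Mathlib.Algebra.Category.Grp.AB
import Literature.AlgebraicGeometry.Modules.SheafHomFunctor
import HarnessLib

/-!
# `𝒪_X`-modules and closed immersions: `i_*` is fully faithful; epi/iso/equality tests on affine opens

Two groups of general facts about Mathlib's abelian category `X.Modules` of sheaves of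
`𝒪_X`-modules on a scheme `X`, used by stub G3 (`stub_conormalSheaf_thickeningMap`) of line
`sigma-ob-kzero-additivity` of the crux `PadicPridhamSemiregularity` (route `PadicSemiregularLift` of
`HodgeConjecture`):

* for a closed immersion `i : Z ⟶ Y`, the direct image `i_* : Mod(𝒪_Z) ⥤ Mod(𝒪_Y)` (Mathlib
  `Scheme.Modules.pushforward i`) is fully faithful (`full_modulesPushforward`,
  `faithful_modulesPushforward`), hence the counit `i^* i_* N ⟶ N` of Mathlib's adjunction
  `Scheme.Modules.pullbackPushforwardAdjunction i` is an isomorphism (`isIso_counit_app_of_isClosedImmersion`;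
  cf. The Stacks Project, Tag 01QY, for quasi-coherent modules). Proof: the underlying abelian sheaf of
  `i_*M` is the restriction of `M` along the continuous functor `i⁻¹ : Opens Y ⥤ Opens Z`, which is
  cover-dense and locally full because `i` is a topological embedding (every open of `Z` is some
  `i⁻¹U`); Mathlib's `Functor.IsCoverDense.restrictHomEquivHom` extends `g : i_*M ⟶ i_*N` uniquely to a
  morphism of abelian sheaves `M ⟶ N`, whose `𝒪_Z`-linearity is checked locally on the opens `i⁻¹U`,
  `U ⊆ Y` affine, where functions on `Z` lift to `Y` (Mathlib `Scheme.Hom.app_surjective`);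
* a morphism of `𝒪_X`-modules is an epimorphism, resp. an isomorphism, resp. equal to another one, as
  soon as it is surjective, resp. bijective, resp. agrees with it on the sections over all AFFINE opens
  (affine opens form a basis: Mathlib `TopCat.Sheaf.isLocallySurjective_iff_epi`,
  `TopCat.Sheaf.isIso_iff_isIso_basis`, `TopCat.Sheaf.hom_ext`), and `(c • φ)_U = c • φ_U` for `c ∈ ℕ`
  (`(c • 𝟙_𝒪)_U a = c·a` on `Literature.AlgebraicGeometry.Modules.unitModule X = 𝒪_X`).

Everything is proved; no definitions (instances are stated as theorems, to be introduced with `haveI`).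
-/

noncomputable section

-- the mandated namespace `Summit.HodgeConjecture.HodgeConjecture.…` repeats a component
set_option linter.dupNamespace false

open CategoryTheory CategoryTheory.Limits AlgebraicGeometry TopologicalSpace Opposite
  Literature.AlgebraicGeometry.Modules

universe u

namespace Summit.HodgeConjecture.HodgeConjecture.Theorems.PadicPridhamSemiregularity

/-! ### The site-theoretic input: `f⁻¹ : Opens Y ⥤ Opens X` for an embedding `f` -/

/-- For an inducing continuous map `f : X → Y` (e.g. an embedding), `f⁻¹ : Opens Y ⥤ Opens X` is
cover-dense: every open of `X` is some `f⁻¹U`. [folklore] -/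
theorem isCoverDense_opensMap {X Y : TopCat.{u}} (f : X ⟶ Y) (hf : Topology.IsInducing f) :
    (Opens.map f).IsCoverDense (Opens.grothendieckTopology X) := by
  refine Functor.isCoverDense_of_generate_singleton_functor_π_mem _ _ fun B => ?_
  obtain ⟨U, hU, hUB⟩ := hf.isOpen_iff.mp B.2
  have hB : (Opens.map f).obj ⟨U, hU⟩ = B := Opens.ext hUB
  refine ⟨⟨U, hU⟩, eqToHom hB, ?_⟩
  rw [Opens.mem_grothendieckTopology]
  intro x hx
  exact ⟨_, eqToHom hB, Sieve.le_generate _ _ _ (Presieve.singleton_self _), by rw [hB]; exact hx⟩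

/-- For any continuous map `f : X → Y`, `f⁻¹ : Opens Y ⥤ Opens X` is locally full: if
`f⁻¹U ≤ f⁻¹V` then `f⁻¹(U ⊓ V) = f⁻¹U`. [folklore] -/
theorem isLocallyFull_opensMap {X Y : TopCat.{u}} (f : X ⟶ Y) :
    (Opens.map f).IsLocallyFull (Opens.grothendieckTopology X) := by
  constructor
  intro U V g
  rw [Opens.mem_grothendieckTopology]
  intro x hx
  refine ⟨(Opens.map f).obj (U ⊓ V), (Opens.map f).map (homOfLE inf_le_left), ?_, ⟨hx, g.le hx⟩⟩
  exact ⟨U ⊓ V, homOfLE inf_le_left, 𝟙 _, ⟨homOfLE inf_le_right, Subsingleton.elim _ _⟩,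
    (Category.id_comp _).symm⟩

/-! ### `i_*` is fully faithful for a closed immersion `i` -/

section Pushforward

variable {Z Y : Scheme.{u}} (i : Z ⟶ Y) [IsClosedImmersion i]

/-- The opens `i⁻¹U` with `U ⊆ Y` affine and `i⁻¹U ≤ V` cover the open `V ⊆ Z` (`i` is an
embedding and affine opens form a basis of `Y`). [folklore] -/
theorem le_iSup_preimage_affineOpens (V : Z.Opens) :
    V ≤ ⨆ U : {U : Y.affineOpens // i ⁻¹ᵁ (U : Y.Opens) ≤ V}, i ⁻¹ᵁ (U.1 : Y.Opens) := by
  intro z hz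
  obtain ⟨U₁, hU₁, hUV⟩ := i.isClosedEmbedding.isInducing.isOpen_iff.mp V.2
  have hz₁ : i.base z ∈ (⟨U₁, hU₁⟩ : Y.Opens) := by
    have hz' : z ∈ V.carrier := hz
    rwa [← hUV] at hz'
  obtain ⟨U, hU, hzU, hle⟩ := Opens.isBasis_iff_nbhd.mp Y.isBasis_affineOpens hz₁
  refine Opens.mem_iSup.mpr ⟨⟨⟨U, hU⟩, fun w hw => ?_⟩, hzU⟩
  have hw' : w ∈ i.base ⁻¹' U₁ := hle hw
  rwa [hUV] at hw'

variable {M N : Z.Modules}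
  (g : (Scheme.Modules.pushforward i).obj M ⟶ (Scheme.Modules.pushforward i).obj N)

/-- **Linearity of extensions.** A morphism of abelian presheaves `f₀ : M ⟶ N` on `Z` whose
restriction along `i⁻¹` is (the underlying map of) an `𝒪_Y`-linear `g : i_*M ⟶ i_*N` is
`𝒪_Z`-linear: checked on the cover of `V` by the `i⁻¹U`, `U` affine, where a function `r|` on `Z`
lifts to a function `b` on `U` and `g_U (b • m) = b • g_U m`. [folklore] -/
theorem map_smul_of_whiskerLeft_eq (f₀ : M.presheaf ⟶ N.presheaf)
    (hf₀ : Functor.whiskerLeft (Opens.map i.base).op f₀ = (Scheme.Modules.toPresheaf Y).map g)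
    (V : Z.Opens) (r : Γ(Z, V)) (m : Γ(M, V)) :
    f₀.app (op V) (r • m) = r • f₀.app (op V) m := by
  have happ : ∀ (U : Y.Opens) (x : Γ(M, i ⁻¹ᵁ U)), f₀.app (op (i ⁻¹ᵁ U)) x = g.app U x :=
    fun U x => ConcreteCategory.congr_hom (congrArg (fun α => α.app (op U)) hf₀) x
  refine TopCat.Sheaf.eq_of_locally_eq' ⟨N.presheaf, N.isSheaf⟩
    (fun U : {U : Y.affineOpens // i ⁻¹ᵁ (U : Y.Opens) ≤ V} => i ⁻¹ᵁ (U.1 : Y.Opens)) V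
    (fun U => homOfLE U.2) (le_iSup_preimage_affineOpens i V) _ _ fun U => ?_
  obtain ⟨⟨U, hU⟩, hUV⟩ := U
  have nat := fun x => ConcreteCategory.congr_hom (f₀.naturality (homOfLE hUV).op) x
  simp only [ConcreteCategory.comp_apply] at nat
  change N.presheaf.map (homOfLE hUV).op _ = N.presheaf.map (homOfLE hUV).op _
  rw [← nat, Scheme.Modules.map_smul, Scheme.Modules.map_smul, ← nat]
  obtain ⟨b, hb⟩ := i.app_surjective U hU (Z.presheaf.map (homOfLE hUV).op r)
  rw [← hb, happ, happ]
  -- `(i♯ b) • m'` is, by definition, the `Γ(Y, U)`-action of `b` on `Γ(i_*M, U) = Γ(M, i⁻¹U)`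
  exact Scheme.Modules.Hom.app_smul g b _

/-- **`i_*` is full**: every `g : i_*M ⟶ i_*N` is `i_*f` (extend the underlying map of `g` along the
cover-dense, locally full `i⁻¹`, Mathlib `Functor.IsCoverDense.restrictHomEquivHom`, and use
`map_smul_of_whiskerLeft_eq`). [folklore] -/
theorem exists_pushforward_map_eq : ∃ f : M ⟶ N, (Scheme.Modules.pushforward i).map f = g := by
  haveI := isCoverDense_opensMap i.base i.isClosedEmbedding.isInducing
  haveI := isLocallyFull_opensMap i.base
  let e := Functor.IsCoverDense.restrictHomEquivHom (G := Opens.map i.base) (ℱ := M.presheaf)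
    (ℱ' := (⟨N.presheaf, N.isSheaf⟩ : TopCat.Sheaf Ab Z.carrier)) (K := Opens.grothendieckTopology Z)
  let f₀ : M.presheaf ⟶ N.presheaf := e ((Scheme.Modules.toPresheaf Y).map g)
  have hf₀ : Functor.whiskerLeft (Opens.map i.base).op f₀ = (Scheme.Modules.toPresheaf Y).map g :=
    Functor.IsCoverDense.sheafHom_restrict_eq _
  refine ⟨⟨PresheafOfModules.homMk f₀ fun V r m => map_smul_of_whiskerLeft_eq i g f₀ hf₀ V.unop r m⟩,
    Scheme.Modules.hom_ext _ _ fun U => ?_⟩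
  ext m
  exact ConcreteCategory.congr_hom (congrArg (fun α => α.app (op U)) hf₀) m

/-- **`i_*` is faithful** (restriction along the cover-dense `i⁻¹` is injective on morphisms into a
sheaf). [folklore] -/
theorem pushforward_map_injective {f₁ f₂ : M ⟶ N}
    (h : (Scheme.Modules.pushforward i).map f₁ = (Scheme.Modules.pushforward i).map f₂) :
    f₁ = f₂ := by
  haveI := isCoverDense_opensMap i.base i.isClosedEmbedding.isInducing
  haveI := isLocallyFull_opensMap i.base
  apply (Scheme.Modules.toPresheaf Z).map_injective
  apply (Functor.IsCoverDense.restrictHomEquivHom (G := Opens.map i.base) (ℱ := M.presheaf)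
    (ℱ' := (⟨N.presheaf, N.isSheaf⟩ : TopCat.Sheaf Ab Z.carrier))
    (K := Opens.grothendieckTopology Z)).symm.injective
  exact congrArg (Scheme.Modules.toPresheaf Y).map h

omit M N g

/-- `i_*` is full for a closed immersion `i`. [folklore] -/
theorem full_modulesPushforward : (Scheme.Modules.pushforward i).Full where
  map_surjective g := exists_pushforward_map_eq i g

/-- `i_*` is faithful for a closed immersion `i`. [folklore] -/
theorem faithful_modulesPushforward : (Scheme.Modules.pushforward i).Faithful where
  map_injective h := pushforward_map_injective i h

/-- **`i^* i_* N ≅ N`**: the counit of `i^* ⊣ i_*` is an isomorphism at every `𝒪_Z`-module `N`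
for a closed immersion `i` (Mathlib `Adjunction.counit_isIso_of_R_fully_faithful`). [folklore] -/
theorem isIso_counit_app_of_isClosedImmersion (N : Z.Modules) :
    IsIso ((Scheme.Modules.pullbackPushforwardAdjunction i).counit.app N) := by
  haveI := full_modulesPushforward i
  haveI := faithful_modulesPushforward i
  infer_instance

end Pushforward

/-! ### Tests on affine opens; `ℕ`-multiples of morphisms -/

section Affine

variable {X : Scheme.{u}} {M N K : X.Modules}

/-- Composites act on sections by composition. [folklore] -/
theorem comp_app_apply (φ : M ⟶ N) (ψ : N ⟶ K) (U : X.Opens) (x : Γ(M, U)) :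
    (φ ≫ ψ).app U x = ψ.app U (φ.app U x) := rfl

/-- `(c • φ)_U m = c • φ_U m` for `c ∈ ℕ`. [folklore] -/
theorem nsmul_app_apply (c : ℕ) (φ : M ⟶ N) (U : X.Opens) (m : Γ(M, U)) :
    (c • φ).app U m = c • φ.app U m := by
  induction c with
  | zero => rw [zero_nsmul, zero_nsmul, Scheme.Modules.Hom.zero_app]; rfl
  | succ c ih => rw [succ_nsmul, succ_nsmul, Scheme.Modules.Hom.add_app, ← ih]; rfl

/-- On the structure sheaf `𝒪_X`: `(c • 𝟙)_U a = c · a` for `c ∈ ℕ`. [folklore] -/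
theorem nsmul_id_unit_app_apply (c : ℕ) (U : X.Opens) (a : Γ(X, U)) :
    ((c • 𝟙 (unitModule X)).app U a : Γ(X, U)) = (c : Γ(X, U)) * a := by
  rw [nsmul_app_apply]
  exact (Nat.cast_smul_eq_nsmul Γ(X, U) c a).symm

/-- Morphisms of `𝒪_X`-modules agreeing on affine opens are equal (Mathlib `TopCat.Sheaf.hom_ext`
on the basis of affine opens). [folklore] -/
theorem hom_ext_of_isAffineOpen (f g : M ⟶ N)
    (h : ∀ U : X.Opens, IsAffineOpen U → f.app U = g.app U) : f = g := by
  apply (Scheme.Modules.toPresheaf X).map_injective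
  have hB : Opens.IsBasis (Set.range ((↑) : X.affineOpens → X.Opens)) := by
    rw [Subtype.range_coe]; exact X.isBasis_affineOpens
  exact TopCat.Sheaf.hom_ext (F := M.presheaf) (F' := ⟨N.presheaf, N.isSheaf⟩) hB
    fun U => h U.1 U.2

/-- A morphism of `𝒪_X`-modules which is surjective on sections over affine opens is an
epimorphism (locally surjective, Mathlib `TopCat.Sheaf.isLocallySurjective_iff_epi`). [folklore] -/
theorem epi_of_app_surjective_of_isAffineOpen (φ : M ⟶ N)
    (h : ∀ U : X.Opens, IsAffineOpen U → Function.Surjective (φ.app U)) : Epi φ := by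
  have hls : TopCat.Presheaf.IsLocallySurjective φ.mapPresheaf := by
    rw [TopCat.Presheaf.isLocallySurjective_iff]
    intro U t x hx
    obtain ⟨V, hV, hxV, hVU⟩ := Opens.isBasis_iff_nbhd.mp X.isBasis_affineOpens hx
    obtain ⟨s, hs⟩ := h V hV (N.presheaf.map (homOfLE hVU).op t)
    exact ⟨V, hVU, ⟨s, hs⟩, hxV⟩
  have h1 : Epi ((SheafOfModules.toSheaf X.ringCatSheaf).map φ) :=
    (TopCat.Sheaf.isLocallySurjective_iff_epi _).mp hls
  have h2 := (SheafOfModules.toSheaf X.ringCatSheaf).epi_of_epi_map h1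
  exact ⟨fun _ _ hh => (@cancel_epi _ _ _ _ _ _ h2 _ _).mp hh⟩

/-- A morphism of `𝒪_X`-modules which is bijective on sections over affine opens is an
isomorphism (Mathlib `TopCat.Sheaf.isIso_iff_isIso_basis` for the basis of affine opens). [folklore] -/
theorem isIso_of_app_bijective_of_isAffineOpen (φ : M ⟶ N)
    (h : ∀ U : X.Opens, IsAffineOpen U → Function.Bijective (φ.app U)) : IsIso φ := by
  let φ' : (⟨M.presheaf, M.isSheaf⟩ : TopCat.Sheaf Ab X.carrier) ⟶ ⟨N.presheaf, N.isSheaf⟩ :=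
    ⟨φ.mapPresheaf⟩
  have hB : Opens.IsBasis (Set.range ((↑) : X.affineOpens → X.Opens)) := by
    rw [Subtype.range_coe]; exact X.isBasis_affineOpens
  have h' : IsIso φ' := TopCat.Sheaf.isIso_iff_isIso_basis hB fun U =>
    (ConcreteCategory.isIso_iff_bijective _).mpr (h U.1 U.2)
  have h'' : IsIso ((Scheme.Modules.toPresheaf X).map φ) :=
    (inferInstance : IsIso ((sheafToPresheaf _ _).map φ'))
  exact isIso_of_reflects_iso φ (Scheme.Modules.toPresheaf X)

end Affine

/-- **Registered sub-goal** (helper stub of `stub_conormalSheaf_thickeningMap`, universe `0`): the counit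
`i^* i_* N ⟶ N` is an isomorphism for a closed immersion `i` (`isIso_counit_app_of_isClosedImmersion`).
[folklore] -/
theorem stub_modulesPushforward_counit_isIso :
  ∀ (Z Y : AlgebraicGeometry.Scheme.{0}) (i : Z ⟶ Y) [AlgebraicGeometry.IsClosedImmersion i]
    (N : Z.Modules),
    CategoryTheory.IsIso ((AlgebraicGeometry.Scheme.Modules.pullbackPushforwardAdjunction i).counit.app N) :=
  fun _ _ i _ N => isIso_counit_app_of_isClosedImmersion i N

end Summit.HodgeConjecture.HodgeConjecture.Theorems.PadicPridhamSemiregularity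

end
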